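import Summits.BirchSwinnertonDyer.Rank1Residual.X2.TwistKodaira
import Literature.NumberTheory.EllipticCurves.Pal2012.QuadraticTwistPeriodProofs
import Literature.NumberTheory.EllipticCurves.ModularityVersionApProofs
import HarnessLib

/-!
# Track U2 (cell `bsd-uniform`, seat u2-p1): the PERIOD IDENTITY (L6) of the genus pair,
# `Ω(E^{(d)}) · Ω(E^{(d·D)}) · |d| = Ω(E) · Ω(E^{(D)})`, PROVED from Pal 2012 Thm. 3.2 (tree theorems)

HONEST FRAMING (cell `bsd-uniform`, HOME run/shared/lean/pub/bsd-uniform/, verbatim in every file of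
the seat): a RELATIVE ("twist-transport") theorem, uniform in the twisting parameter `d`, CONDITIONAL
on NAMED binders of two provenances (referee V17 C2-F1): PER BASE — `BSD₂(E) ∧ BSD₂(E^{(D)})`
(`hbsd`/`hbsd₀`), `Ш(E)[2] = Ш(E^{(D)})[2] = 0` (`hSha`/`hSha₀`), `r_an = 1 / 0` (`hr`/`hr₀`), (H-y)
`y_K ∉ 2E(K)` (`hHy`), `c(E)` odd (`hc`); PER TWIST PAIR `(E^{(d)}, E^{(d·d_K)})` — the (※) identity
with odd indices `n, m` (`hId`) and the rank-`0` member's Zhai unit (`hZhai`); until each PER-TWIST-PAIR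
binder is a tree theorem from base invariants, every transported pair is CERTIFICATE-DERIVED in that
binder, whatever the base. It converts PAIRS, never the class X5; books nothing; moves no census
number; no per-curve certificate is counted as a uniform theorem.

THIS FILE (support, theorems only; no `def`, no named fact) proves the PERIOD INPUT (L6) of the
(※) identity `hId` (`CorC.gzQuotient_identity`, binder `hL6 : Ω_A·Ω_B = Ω_{A₀}·Ω_{B₀}/M`): for a
globally minimal `E` (model `W`) of conductor `N`, a negative `D ≡ 1 (mod 4)` and `d ≡ 1 (mod 4)`
with `d·D` square-free and prime to `N`, and globally minimal models `W₁ ≅ E^{(d)}`, `W₂ ≅ E^{(d·D)}`,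
`W₀ ≅ E^{(D)}` (and `W₂ ≅ (E^{(D)})^{(d)}`):
`Ω(W₁) · Ω(W₂) · |d| = Ω(W) · Ω(W₀)` (`Ω = realPeriodRat`, all real components).
Proof. `E` has good reduction at every prime of `d·D` (they do not divide `N`), so Pal's rational
twisting factor is `ũ = ±1` for each of the square-free twists by `d`, `D`, `d·D` (all `≡ 1 (mod 4)`;
tree theorem `u_eq_one_or_eq_neg_one_of_smul_quadraticTwist_of_squarefree`, Pal Prop. 2.5 / Cor. 2.6).
If `d > 0`: `√d·Ω(W₁) = Ω(W)` and `√d·Ω(W₂) = Ω(W₀)` (Pal Thm. 3.2, case `d > 0`, for `E` and for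
`E^{(D)}`, which is good at the primes of `d`). If `d < 0`: `Ω(W₁)√|d| = c_∞(E)·|Ω⁻(E)|` and
`Ω(W₀)√|D| = c_∞(E)·|Ω⁻(E)|` (Pal Thm. 3.2, case `d < 0`), while `√(dD)·Ω(W₂) = Ω(W)` (case `d > 0`
for the twist by `d·D > 0`); multiplying out gives the identity in both cases.

## Contents
* `realPeriodRat_genusPair_mul_natAbs` — THE PERIOD IDENTITY (L6).

References: Pal 2012 Prop. 2.5, Cor. 2.6, Thm. 3.2 [Pal2012]; Silverman AEC VII.1 Prop. 1.3,
X.5 Cor. 5.4 [SilvermanAEC2009]; `p2/idea-2/T4-PROOF.md` v1.9b L6 (evidence).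
-/

noncomputable section

open scoped Classical

open NumberField WeierstrassCurve IsDedekindDomain Rat.HeightOneSpectrum

namespace Summit.BirchSwinnertonDyer.Uniform.U2

/-- **THE PERIOD IDENTITY (L6) of the genus pair — PROVED.** For `W` a globally minimal model of
`E/ℚ` (conductor `N`), `D < 0` and `d` with `d ≡ D ≡ 1 (mod 4)`, `d·D` square-free and prime to `N`,
and globally minimal models `W₁ ≅ E^{(d)}`, `W₂ ≅ E^{(d·D)}`, `W₀ ≅ E^{(D)}` (with `W₂ ≅ W₀^{(d)}`):
`Ω(W₁) · Ω(W₂) · |d| = Ω(W) · Ω(W₀)`. From Pal 2012 Thm. 3.2 (both signs) with `ũ = ±1`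
(Prop. 2.5 / Cor. 2.6: square-free twisting parameter `≡ 1 (mod 4)` at whose primes the curve is
good). [cite: Pal2012, Thm. 3.2 with Prop. 2.5 and Cor. 2.6] -/
theorem realPeriodRat_genusPair_mul_natAbs
    (W W₀ W₁ W₂ : WeierstrassCurve ℚ) [W.IsElliptic] [W₀.IsElliptic] [W₁.IsElliptic] [W₂.IsElliptic]
    [W.IsGloballyMinimal] [W₀.IsGloballyMinimal] [W₁.IsGloballyMinimal] [W₂.IsGloballyMinimal]
    {d D : ℤ} (hd4 : d % 4 = 1) (hD4 : D % 4 = 1) (hD : D < 0)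
    (hsqf : Squarefree (d * D)) (hgcd : Int.gcd (d * D) (W.conductorNorm ℤ) = 1)
    (h₁ : ∃ C : VariableChange ℚ, C • W₁ = W.quadraticTwist (d : ℚ))
    (h₂ : ∃ C : VariableChange ℚ, C • W₂ = W.quadraticTwist ((d * D : ℤ) : ℚ))
    (h₂' : ∃ C : VariableChange ℚ, C • W₂ = W₀.quadraticTwist (d : ℚ))
    (h₀ : ∃ C : VariableChange ℚ, C • W₀ = W.quadraticTwist (D : ℚ)) :
    W₁.realPeriodRat * W₂.realPeriodRat * (d.natAbs : ℝ) = W.realPeriodRat * W₀.realPeriodRat := by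
  have hd0 : d ≠ 0 := by rintro rfl; norm_num at hd4
  -- square-freeness and coprimality bookkeeping
  have hsqd : Squarefree d := Squarefree.of_mul_left hsqf
  have hsqD : Squarefree D := Squarefree.of_mul_right hsqf
  have hdD4 : (d * D) % 4 = 1 := by
    have := Int.mul_emod d D 4; rw [hd4, hD4] at this; simpa using this
  have hgoodW : ∀ v : HeightOneSpectrum (𝓞 ℚ), ((primesEquiv v : ℕ) : ℤ) ∣ d * D →
      W.HasGoodReductionAt v := by
    intro v hv
    by_contra hg
    have hpN := (W.dvd_conductorNorm_iff v).mpr hg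
    have hp : (primesEquiv v : ℕ).Prime := (primesEquiv v).2
    have h1 : (primesEquiv v : ℕ) ∣ Int.gcd (d * D) (W.conductorNorm ℤ) :=
      Int.dvd_gcd hv (Int.natCast_dvd_natCast.mpr hpN)
    rw [hgcd] at h1
    exact hp.one_lt.ne' (Nat.dvd_one.mp h1)
  have hVd : ∀ v : HeightOneSpectrum (𝓞 ℚ), ((primesEquiv v : ℕ) : ℤ) ∣ d →
      W.HasGoodReductionAt v ∨ W.HasMultiplicativeReductionAt v :=
    fun v hv => Or.inl (hgoodW v (dvd_mul_of_dvd_left hv D))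
  have hVD : ∀ v : HeightOneSpectrum (𝓞 ℚ), ((primesEquiv v : ℕ) : ℤ) ∣ D →
      W.HasGoodReductionAt v ∨ W.HasMultiplicativeReductionAt v :=
    fun v hv => Or.inl (hgoodW v (dvd_mul_of_dvd_right hv d))
  have hVdD : ∀ v : HeightOneSpectrum (𝓞 ℚ), ((primesEquiv v : ℕ) : ℤ) ∣ d * D →
      W.HasGoodReductionAt v ∨ W.HasMultiplicativeReductionAt v :=
    fun v hv => Or.inl (hgoodW v hv)
  -- the variable changes in Pal's direction
  obtain ⟨C₁, hC₁⟩ := h₁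
  obtain ⟨C₂, hC₂⟩ := h₂
  obtain ⟨C₂', hC₂'⟩ := h₂'
  obtain ⟨C₀, hC₀⟩ := h₀
  have hW₁ : C₁⁻¹ • W.quadraticTwist (d : ℚ) = W₁ := by rw [← hC₁, inv_smul_smul]
  have hW₂ : C₂⁻¹ • W.quadraticTwist ((d * D : ℤ) : ℚ) = W₂ := by rw [← hC₂, inv_smul_smul]
  have hW₂' : C₂'⁻¹ • W₀.quadraticTwist (d : ℚ) = W₂ := by rw [← hC₂', inv_smul_smul]
  have hW₀ : C₀⁻¹ • W.quadraticTwist (D : ℚ) = W₀ := by rw [← hC₀, inv_smul_smul]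
  -- `E^{(D)}` is good at the primes of `d`
  have hV₀d : ∀ v : HeightOneSpectrum (𝓞 ℚ), ((primesEquiv v : ℕ) : ℤ) ∣ d →
      W₀.HasGoodReductionAt v ∨ W₀.HasMultiplicativeReductionAt v := by
    intro v hv
    have hp : (primesEquiv v : ℕ).Prime := (primesEquiv v).2
    have hvD : ¬ ((primesEquiv v : ℕ) : ℤ) ∣ D := fun hvD =>
      (Nat.prime_iff_prime_int.mp hp).not_unit (hsqf _ (mul_dvd_mul hv hvD))
    exact Or.inl (Rank1Residual.X2.hasGoodReductionAt_twist_of_not_dvd W v (k := (D - 1) / 4)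
      (by omega) hvD (hgoodW v (dvd_mul_of_dvd_left hv D)) C₀⁻¹ hW₀)
  have hnat : (d.natAbs : ℝ) = |(d : ℝ)| := by
    rw [Nat.cast_natAbs, Int.cast_abs]
  rcases lt_or_gt_of_ne hd0 with hneg | hpos
  · -- `d < 0`
    have hdq : ((d : ℚ)) < 0 := by exact_mod_cast hneg
    have hDq : ((D : ℚ)) < 0 := by exact_mod_cast hD
    have hdD : 0 < d * D := mul_pos_of_neg_of_neg hneg hD
    have e1 := W.realPeriodRat_mul_sqrt_of_twist_of_neg' hdq W₁ C₁⁻¹ hW₁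
    have e0 := W.realPeriodRat_mul_sqrt_of_twist_of_neg' hDq W₀ C₀⁻¹ hW₀
    have e2 := W.sqrt_mul_realPeriodRat_eq_of_twist_of_pos_of_squarefree hdD hdD4 hsqf hVdD W₂ C₂⁻¹ hW₂
    have hu1 : |(((C₁⁻¹).u : ℚ) : ℝ)| = 1 := by
      rcases W.u_eq_one_or_eq_neg_one_of_smul_quadraticTwist_of_squarefree hd4 hsqd hVd W₁ C₁⁻¹ hW₁
        with h | h <;> rw [h] <;> simp
    have hu0 : |(((C₀⁻¹).u : ℚ) : ℝ)| = 1 := by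
      rcases W.u_eq_one_or_eq_neg_one_of_smul_quadraticTwist_of_squarefree hD4 hsqD hVD W₀ C₀⁻¹ hW₀
        with h | h <;> rw [h] <;> simp
    rw [hu1, one_mul, Rat.cast_intCast] at e1
    rw [hu0, one_mul, Rat.cast_intCast] at e0
    set A := Real.sqrt (-(d : ℝ)) with hA
    set B := Real.sqrt (-(D : ℝ)) with hB
    have hdR : (d : ℝ) < 0 := by exact_mod_cast hneg
    have hDR : (D : ℝ) < 0 := by exact_mod_cast hD
    have hA0 : 0 ≤ -(d : ℝ) := by linarith
    have hB0 : 0 ≤ -(D : ℝ) := by linarith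
    have hBpos : 0 < B := Real.sqrt_pos.mpr (by linarith)
    have hAB : Real.sqrt ((d * D : ℤ) : ℝ) = A * B := by
      rw [hA, hB, ← Real.sqrt_mul hA0]
      congr 1
      push_cast
      ring
    rw [hAB] at e2
    have hdA : (d.natAbs : ℝ) = A * A := by
      rw [hnat, abs_of_neg (by exact_mod_cast hneg), hA, Real.mul_self_sqrt hA0]
    rw [hdA]
    apply mul_right_cancel₀ hBpos.ne'
    linear_combination (A * B * W₂.realPeriodRat) * e1 +
      ((W.baseChange ℝ).numRealComponents * W.imaginaryPeriodRat) * e2 - W.realPeriodRat * e0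
  · -- `d > 0`
    have e1 := W.sqrt_mul_realPeriodRat_eq_of_twist_of_pos_of_squarefree hpos hd4 hsqd hVd W₁ C₁⁻¹ hW₁
    have e2 := W₀.sqrt_mul_realPeriodRat_eq_of_twist_of_pos_of_squarefree hpos hd4 hsqd hV₀d W₂ C₂'⁻¹
      hW₂'
    have hd0' : 0 ≤ (d : ℝ) := by exact_mod_cast hpos.le
    have hdA : (d.natAbs : ℝ) = Real.sqrt (d : ℝ) * Real.sqrt (d : ℝ) := by
      rw [hnat, abs_of_pos (by exact_mod_cast hpos), Real.mul_self_sqrt hd0']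
    rw [hdA, ← e1, ← e2]
    ring

end Summit.BirchSwinnertonDyer.Uniform.U2

end
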